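import Mathlib.Algebra.Order.Chebyshev
import Literature.Analysis.OperatorTheory.NelsonAPrioriEstimate
import HarnessLib

/-!
# Nelson's sum-of-squares recursion with absorption: the interior estimate for `R(Δ) f = 0`

This is the third file on Nelson's recursion, after
`Literature.Analysis.OperatorTheory.NelsonSumOfSquares` (skew-symmetric operators, `Δ`-stable
finite-dimensional space `T`: factorial bounds) and
`Literature.Analysis.OperatorTheory.NelsonAPrioriEstimate` (weighted, almost skew families; still
a `Δ`-stable `T` on which the weights of ALL elements are controlled a priori). Here the
finite-dimensional `Δ`-stable space is replaced by a single vector `f` with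

  `R(Δ) f = 0`, i.e. `Δ^{A₀} f = ∑_{i < A₀} r_i Δ^i f`  (`Δ = ∑_i A_i²`),

and NOTHING is assumed on the intermediate vectors `Δ f, …, Δ^{A₀-1} f`: their weighted norms are
shown to be controlled by those of `f` itself. This is interior elliptic regularity for the
operator `R(Δ)` — the analytic content of Harish-Chandra's theorem that `K`-finite `Z(𝔤)`-finite
functions on a reductive group have derivatives locally controlled by the function (the input of
Borel–Jacquet 1979, 4.3 (ii)), in the form needed by `Literature/NumberTheory/Automorphic` —
obtained here from the sum-of-squares structure by integration by parts alone (no Fourier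
analysis, no fundamental solutions).

## Setting

`(A_i)_{i ∈ ι}` finitely many linear operators on a complex vector space `V` with
`A_i A_m - A_m A_i = ∑_l c_{iml} A_l`, `|c_{iml}| ≤ c`; weights `M_m : V →ₗ[ℂ] H`, `m ∈ ℕ`, into a
complex inner product space, which are
* monotone: `‖M_m v‖ ≤ ‖M_{m+1} v‖` (think: `M_m v = χ_m · v ∈ L²`, `χ_m` a cut-off equal to `1`
  on the ball of radius `s_m`, supported in the ball of radius `s_{m+1}`, `s_m ↑ S` geometrically);
* pointwise bounded: `sup_m ‖M_m v‖ < ∞` for every `v` (continuity on the closed ball `B̄_S`);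
* almost skew with geometric defect:
  `|⟪M_m (A_i u), M_m w⟫ + ⟪M_m u, M_m (A_i w)⟫| ≤ D 2^m ‖M_{m+1} u‖ ‖M_m w‖`
  (integration by parts; the slope of `χ_m` is `≲ 2^m`).

## Main statements

* `closing` — **the closing lemma** (pure real numbers): a finite ranked family `u ≥ 0`, bounded
  by its attained maximum `U`, with `u x ≤ a` in rank `0` and
  `u x ≤ C (√(u y · U) + u y)` for some `y` of smaller rank, satisfies `U ≤ 2 L_C(n, 1/2) a`
  (`closingL`; the `ε U + C_ε a` induction of the absorption argument, `closing_step`).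
* `sum_norm_weight_apply_le` — **Caccioppoli**:
  `∑_i ‖M_m (A_i g)‖ ≤ √d √(‖M_{m+1} g‖ ‖M_{m+1} (Δ g)‖) + d D 2^m ‖M_{m+1} g‖`.
* `levelSum A M f j k m = Σ_{j,k}(m) = ∑_{|α| = k} ‖M_m (A_α Δ^j f)‖` and the scaled suprema
  `scaledSup A M f j k = Θ_{j,k} = sup_m Σ_{j,k}(m) / 2^{m (2j+k)}` (the order `2j + k` of
  `A_α Δ^j` is its homogeneity weight);
* `levelSum_succ_le` — the recursion
  `Σ_{j,k+1}(m) ≤ √d √(Σ_{j,k}(m+1)) √(Σ_{j+1,k}(m+1) + 2 k d^{k+2} c Σ_{j,k+1}(m+1)) + d D 2^m Σ_{j,k}(m+1)`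
  (Caccioppoli for `g = A_α Δ^j f`, `Δ g = A_α Δ^{j+1} f + [Δ, A_α] Δ^j f`, the commutator being
  `2 k d²` words of length `k + 1` — `norm_map_wordEnd_commLaplacianEnd_le` of the a-priori file —
  and Cauchy–Schwarz over the words);
* `scaledSup_succ_le` — after the supremum over `m` every term is homogeneous (`stepA_real`) and
  the finite `Θ_{j,k+1}` on the right is absorbed (`absorb_real`):
  `Θ_{j,k+1} ≤ 4 Q √d √(Θ_{j,k} Θ_{j+1,k}) + (2 Q² d C₁ + 2 Q d D) Θ_{j,k}`;
  `scaledSup_succ_zero_le` (`Θ_{j+1,0} ≤ Θ_{j,2}`) and `scaledSup_top_le`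
  (`Θ_{A₀,k} ≤ ∑_{i<A₀} |r_i| Θ_{i,k}`: the equation closes the system at the top order, with
  LOWER orders on the right);
* `sum_norm_weight_wordEnd_le_interiorConst` — **the interior estimate**: if `‖M_m f‖ ≤ a` for all
  `m`, then for `k ≤ k_max` (`k_max ≥ 2`, `A₀ ≥ 1`)
  `∑_{|α| = k} ‖M_0 (A_α f)‖ ≤ interiorConst(d, c, D, A₀, r, k_max) · a`,
  with an explicit constant (`chainConst`, `interiorConst`) depending on nothing else.

Everything here is proved; the definitions are the two sums, the constants, and nothing else.

## References

* E. Nelson, *Analytic vectors*, Ann. of Math. 70 (1959), 572–615, §6 [Nelson1959] (not held).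
* M. P. Gaffney, *A special Stokes's theorem for complete Riemannian manifolds*, Ann. of Math. 60
  (1954), 140–145 (the cut-off device) (not held).
* L. Nirenberg, *Remarks on strongly elliptic partial differential equations*, Comm. Pure Appl.
  Math. 8 (1955), 649–675 (interior regularity by absorption) (not held).
* Harish-Chandra, *Discrete series for semisimple Lie groups. II*, Acta Math. 116 (1966), §8
  [HarishChandra1966]; A. Borel, *Représentations de groupes localement compacts*, LNM 276 (1972),
  Thm. 3.18 [Borel1972] (held); A. Borel, H. Jacquet, *Automorphic forms and automorphic
  representations*, Proc. Sympos. Pure Math. 33.1 (1979), 4.3 [BorelJacquetCorvallis1979]: the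
  application.
-/

open scoped InnerProductSpace
open Finset

noncomputable section

namespace Literature.Analysis.OperatorTheory

/-! ## 1. The closing lemma: absorption in a finite system of square-root inequalities -/

/-- The constants of the closing lemma: `L_C(0, ε) = 1`,
`L_C(m+1, ε) = C (3C/(4ε) + 1) · L_C(m, (ε/(3C))²)`. [folklore] -/
def closingL (C : ℝ) : ℕ → ℝ → ℝ
  | 0, _ => 1
  | m + 1, ε => C * (3 * C / (4 * ε) + 1) * closingL C m ((ε / (3 * C)) ^ 2)

/-- `1 ≤ L_C(m, ε)` for `C ≥ 1`, `ε > 0`. [folklore] -/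
theorem one_le_closingL {C : ℝ} (hC : 1 ≤ C) : ∀ (m : ℕ) {ε : ℝ}, 0 < ε → 1 ≤ closingL C m ε := by
  intro m
  induction m with
  | zero => intro ε _; simp [closingL]
  | succ m ih =>
    intro ε hε
    have hC0 : 0 < C := by linarith
    have hδ : 0 < (ε / (3 * C)) ^ 2 := by positivity
    have h1 : 1 ≤ 3 * C / (4 * ε) + 1 := le_add_of_nonneg_left (by positivity)
    have h2 := ih hδ
    change 1 ≤ C * (3 * C / (4 * ε) + 1) * closingL C m ((ε / (3 * C)) ^ 2)
    calc (1 : ℝ) = 1 * 1 * 1 := by ring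
      _ ≤ C * (3 * C / (4 * ε) + 1) * closingL C m ((ε / (3 * C)) ^ 2) :=
        mul_le_mul (mul_le_mul hC h1 zero_le_one hC0.le) h2 zero_le_one (by positivity)

/-- `0 ≤ L_C(m, ε)`. [folklore] -/
theorem closingL_nonneg {C : ℝ} (hC : 1 ≤ C) (m : ℕ) {ε : ℝ} (hε : 0 < ε) : 0 ≤ closingL C m ε :=
  zero_le_one.trans (one_le_closingL hC m hε)

/-- `L_C(m, ε)` is monotone in `m`. [folklore] -/
theorem closingL_le_succ {C : ℝ} (hC : 1 ≤ C) :
    ∀ (m : ℕ) {ε : ℝ}, 0 < ε → closingL C m ε ≤ closingL C (m + 1) ε := by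
  intro m
  induction m with
  | zero =>
    intro ε hε
    simpa [closingL] using one_le_closingL hC 1 hε
  | succ m ih =>
    intro ε hε
    have hC0 : 0 < C := by linarith
    have hδ : 0 < (ε / (3 * C)) ^ 2 := by positivity
    change C * (3 * C / (4 * ε) + 1) * closingL C m ((ε / (3 * C)) ^ 2) ≤
      C * (3 * C / (4 * ε) + 1) * closingL C (m + 1) ((ε / (3 * C)) ^ 2)
    exact mul_le_mul_of_nonneg_left (ih hδ) (by positivity)

/-- `L_C(m, ε) ≤ L_C(n, ε)` for `m ≤ n`. [folklore] -/
theorem closingL_mono {C : ℝ} (hC : 1 ≤ C) {m n : ℕ} (hmn : m ≤ n) {ε : ℝ} (hε : 0 < ε) :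
    closingL C m ε ≤ closingL C n ε := by
  induction n, hmn using Nat.le_induction with
  | base => exact le_rfl
  | succ n _ ih => exact ih.trans (closingL_le_succ hC n hε)

/-- **One absorption step.** If `u_p ≤ (ε/(3C))² U + L a` and `u' ≤ C (√(u_p U) + u_p)` then
`u' ≤ ε U + C (3C/(4ε) + 1) L a` (`0 < ε ≤ 1 ≤ C`; the geometric mean is split as
`√(L a U) ≤ η U + L a /(4η)` with `η = ε/(3C)`). [folklore] -/
theorem closing_step {C U a L up u' ε : ℝ} (hC : 1 ≤ C) (hU : 0 ≤ U) (ha : 0 ≤ a) (hL : 0 ≤ L)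
    (hε : 0 < ε) (hε1 : ε ≤ 1)
    (hp : up ≤ (ε / (3 * C)) ^ 2 * U + L * a)
    (hu : u' ≤ C * (Real.sqrt (up * U) + up)) :
    u' ≤ ε * U + C * (3 * C / (4 * ε) + 1) * L * a := by
  have hC0 : 0 < C := by linarith
  set η : ℝ := ε / (3 * C) with hη
  have hη0 : 0 < η := by positivity
  have hLa : 0 ≤ L * a := mul_nonneg hL ha
  -- `√(u_p U) ≤ 2 η U + L a / (4 η)`
  have hW0 : 0 ≤ 2 * η * U + L * a / (4 * η) := by positivity
  have hsqrt : Real.sqrt (up * U) ≤ 2 * η * U + L * a / (4 * η) := by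
    have hprod : up * U ≤ (2 * η * U + L * a / (4 * η)) ^ 2 := by
      have h1 : up * U ≤ (η ^ 2 * U + L * a) * U := mul_le_mul_of_nonneg_right hp hU
      have h2 : (η ^ 2 * U + L * a) * U ≤ (2 * η * U + L * a / (4 * η)) ^ 2 := by
        have hcross : 2 * (2 * η * U) * (L * a / (4 * η)) = L * a * U := by
          field_simp
          ring
        nlinarith [sq_nonneg (2 * η * U), sq_nonneg (L * a / (4 * η)), mul_nonneg hLa hU,
          sq_nonneg η, mul_nonneg (mul_nonneg (sq_nonneg η) hU) hU]
      exact h1.trans h2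
    calc Real.sqrt (up * U) ≤ Real.sqrt ((2 * η * U + L * a / (4 * η)) ^ 2) :=
          Real.sqrt_le_sqrt hprod
      _ = 2 * η * U + L * a / (4 * η) := Real.sqrt_sq hW0
  -- the two pieces
  have hA : C * Real.sqrt (up * U) ≤ 2 * ε / 3 * U + 3 * C ^ 2 / (4 * ε) * (L * a) := by
    have := mul_le_mul_of_nonneg_left hsqrt hC0.le
    have e1 : C * (2 * η * U) = 2 * ε / 3 * U := by rw [hη]; field_simp
    have e2 : C * (L * a / (4 * η)) = 3 * C ^ 2 / (4 * ε) * (L * a) := by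
      rw [hη]; field_simp
    calc C * Real.sqrt (up * U) ≤ C * (2 * η * U + L * a / (4 * η)) := this
      _ = 2 * ε / 3 * U + 3 * C ^ 2 / (4 * ε) * (L * a) := by rw [mul_add, e1, e2]
  have hB : C * up ≤ ε / 9 * U + C * (L * a) := by
    have := mul_le_mul_of_nonneg_left hp hC0.le
    have e1 : C * ((ε / (3 * C)) ^ 2 * U) = ε ^ 2 / (9 * C) * U := by field_simp; ring
    have hε2 : ε ^ 2 / (9 * C) * U ≤ ε / 9 * U := by
      refine mul_le_mul_of_nonneg_right ?_ hU
      rw [div_le_div_iff₀ (by positivity) (by norm_num)]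
      nlinarith [mul_le_mul_of_nonneg_left (hε1.trans hC) hε.le]
    calc C * up ≤ C * ((ε / (3 * C)) ^ 2 * U + L * a) := this
      _ = ε ^ 2 / (9 * C) * U + C * (L * a) := by rw [mul_add, e1]
      _ ≤ ε / 9 * U + C * (L * a) := add_le_add hε2 le_rfl
  calc u' ≤ C * (Real.sqrt (up * U) + up) := hu
    _ = C * Real.sqrt (up * U) + C * up := mul_add _ _ _
    _ ≤ (2 * ε / 3 * U + 3 * C ^ 2 / (4 * ε) * (L * a)) + (ε / 9 * U + C * (L * a)) :=
        add_le_add hA hB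
    _ = (2 * ε / 3 + ε / 9) * U + C * (3 * C / (4 * ε) + 1) * L * a := by ring
    _ ≤ ε * U + C * (3 * C / (4 * ε) + 1) * L * a := by
        refine add_le_add (mul_le_mul_of_nonneg_right ?_ hU) le_rfl
        linarith

/-- **The closing lemma.** Let `u : σ → ℝ≥0` be a finite family with a rank function, bounded by
`U` with `U` attained, such that the elements of rank `0` are `≤ a` and every element of positive
rank satisfies `u x ≤ C (√(u y · U) + u y)` for some `y` of smaller rank. Then `U ≤ K a` with
`K = 2 L_C(n, 1/2)`, `n` a bound for the ranks: by induction on the rank,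
`u x ≤ ε U + L_C(rank x, ε) a` for every `0 < ε ≤ 1` (`closing_step`), and `ε = 1/2` at a point
where `U` is attained absorbs. This is the bookkeeping of the absorption argument of interior
elliptic regularity. [folklore] -/
theorem closing {σ : Type*} {C : ℝ} (hC : 1 ≤ C) (u : σ → ℝ) (rank : σ → ℕ) {n : ℕ}
    (hn : ∀ x, rank x ≤ n) {a U : ℝ} (hu0 : ∀ x, 0 ≤ u x) (ha : 0 ≤ a) (hU : ∀ x, u x ≤ U)
    (hmax : ∃ x, U ≤ u x) (hroot : ∀ x, rank x = 0 → u x ≤ a)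
    (hstep : ∀ x, rank x ≠ 0 → ∃ y, rank y < rank x ∧ u x ≤ C * (Real.sqrt (u y * U) + u y)) :
    U ≤ 2 * closingL C n (1 / 2) * a := by
  obtain ⟨x₀, hx₀⟩ := hmax
  have hU0 : 0 ≤ U := (hu0 x₀).trans (hU x₀)
  -- the claim, by induction on the rank
  have claim : ∀ r : ℕ, ∀ x, rank x ≤ r → ∀ ε : ℝ, 0 < ε → ε ≤ 1 →
      u x ≤ ε * U + closingL C r ε * a := by
    intro r
    induction r with
    | zero =>
      intro x hx ε hε _
      have h := hroot x (Nat.le_zero.mp hx)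
      have : 0 ≤ ε * U := by positivity
      simp only [closingL, one_mul]
      linarith
    | succ r ih =>
      intro x hx ε hε hε1
      by_cases hxr : rank x ≤ r
      · exact (ih x hxr ε hε hε1).trans (add_le_add le_rfl
          (mul_le_mul_of_nonneg_right (closingL_le_succ hC r hε) ha))
      · have hx0 : rank x ≠ 0 := by omega
        obtain ⟨y, hy, hxy⟩ := hstep x hx0
        have hyr : rank y ≤ r := by omega
        have hC0 : 0 < C := by linarith
        have hδ0 : 0 < (ε / (3 * C)) ^ 2 := by positivity
        have hδ1 : (ε / (3 * C)) ^ 2 ≤ 1 := by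
          have h1 : ε / (3 * C) ≤ 1 := by
            rw [div_le_one (by positivity)]; linarith
          have h0 : 0 ≤ ε / (3 * C) := by positivity
          nlinarith
        have hp := ih y hyr _ hδ0 hδ1
        have := closing_step hC hU0 ha (closingL_nonneg hC r hδ0) hε hε1 hp hxy
        simpa only [closingL, mul_assoc] using this
  have h := claim n x₀ (hn x₀) (1 / 2) (by norm_num) (by norm_num)
  linarith


/-! ## 2. The Caccioppoli inequality for geometric weights -/

section Nelson

variable {V : Type*} [AddCommGroup V] [Module ℂ V]
  {H : Type*} [NormedAddCommGroup H] [InnerProductSpace ℂ H] {ι : Type*} [Fintype ι]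

/-- `x ≥ 0`, `x² ≤ a + b x` with `a, b ≥ 0` forces `x ≤ √a + b`. [folklore] -/
theorem le_sqrt_add_of_sq_le {x a b : ℝ} (ha : 0 ≤ a) (hb : 0 ≤ b)
    (h : x ^ 2 ≤ a + b * x) : x ≤ Real.sqrt a + b := by
  by_contra hlt
  push Not at hlt
  have hs := Real.sq_sqrt ha
  have hs0 := Real.sqrt_nonneg a
  have h1 : Real.sqrt a < x - b := by linarith
  have h2 : a < (x - b) ^ 2 := by
    have := pow_lt_pow_left₀ h1 hs0 two_ne_zero
    rwa [hs] at this
  nlinarith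

/-- **Caccioppoli's inequality for geometric weights.** Let `M_m : V → H` be linear weights into
an inner product space which are monotone (`‖M_m v‖ ≤ ‖M_{m+1} v‖`) and almost skew for the
family `A` with geometric defect (`|⟪M_m (A_i u), M_m w⟫ + ⟪M_m u, M_m (A_i w)⟫| ≤
D 2^m ‖M_{m+1} u‖ ‖M_m w‖`: integration by parts, the cut-off of level `m` having slope `≲ 2^m`
and support where the cut-off of level `m + 1` equals `1`). Then for every `g`,
`∑_i ‖M_m (A_i g)‖ ≤ √d · √(‖M_{m+1} g‖ · ‖M_{m+1} (Δ g)‖) + d D 2^m ‖M_{m+1} g‖`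
(`Δ = ∑ A_i²`): `∑_i ‖M_m A_i g‖² = -Re ⟪M_m g, M_m Δ g⟫ + defects`. Gaffney 1954; Nelson
1959, §6. [folklore] -/
theorem sum_norm_weight_apply_le (A : ι → Module.End ℂ V) (M : ℕ → V →ₗ[ℂ] H)
    (hmono : ∀ (m : ℕ) (v : V), ‖M m v‖ ≤ ‖M (m + 1) v‖) {D : ℝ} (hD : 0 ≤ D)
    (hskew : ∀ (m : ℕ) (i : ι) (u w : V),
      ‖⟪M m (A i u), M m w⟫_ℂ + ⟪M m u, M m (A i w)⟫_ℂ‖ ≤ D * 2 ^ m * ‖M (m + 1) u‖ * ‖M m w‖)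
    (m : ℕ) (g : V) :
    ∑ i, ‖M m (A i g)‖ ≤
      Real.sqrt (Fintype.card ι) * Real.sqrt (‖M (m + 1) g‖ * ‖M (m + 1) (laplacianEnd A g)‖) +
        Fintype.card ι * D * 2 ^ m * ‖M (m + 1) g‖ := by
  set S : ℝ := ∑ i, ‖M m (A i g)‖ with hS
  set n : ℝ := ‖M (m + 1) g‖ with hn
  set β : ℝ := D * 2 ^ m * n with hβ
  have hn0 : 0 ≤ n := norm_nonneg _
  have hβ0 : 0 ≤ β := by positivity
  have hS0 : 0 ≤ S := Finset.sum_nonneg fun i _ ↦ norm_nonneg _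
  -- each square through almost-skewness
  have hterm : ∀ i, ‖M m (A i g)‖ ^ 2 ≤
      -RCLike.re ⟪M m g, M m (A i (A i g))⟫_ℂ + β * ‖M m (A i g)‖ := by
    intro i
    have hd := hskew m i g (A i g)
    have e : (‖M m (A i g)‖ ^ 2 : ℝ) = RCLike.re ⟪M m (A i g), M m (A i g)⟫_ℂ := by
      rw [← inner_self_eq_norm_sq (𝕜 := ℂ)]
    have hre : RCLike.re (⟪M m (A i g), M m (A i g)⟫_ℂ + ⟪M m g, M m (A i (A i g))⟫_ℂ) ≤
        β * ‖M m (A i g)‖ := by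
      refine (RCLike.re_le_norm _).trans (hd.trans (le_of_eq ?_))
      rw [hβ, hn]
    rw [map_add] at hre
    rw [e]
    linarith
  have hlap : ∑ i, -RCLike.re ⟪M m g, M m (A i (A i g))⟫_ℂ =
      -RCLike.re ⟪M m g, M m (laplacianEnd A g)⟫_ℂ := by
    rw [laplacianEnd_apply, map_sum, inner_sum, map_sum, Finset.sum_neg_distrib]
  -- the sum of squares
  have hQ : ∑ i, ‖M m (A i g)‖ ^ 2 ≤ n * ‖M (m + 1) (laplacianEnd A g)‖ + β * S := by
    calc ∑ i, ‖M m (A i g)‖ ^ 2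
        ≤ ∑ i, (-RCLike.re ⟪M m g, M m (A i (A i g))⟫_ℂ + β * ‖M m (A i g)‖) :=
          Finset.sum_le_sum fun i _ ↦ hterm i
      _ = -RCLike.re ⟪M m g, M m (laplacianEnd A g)⟫_ℂ + β * S := by
          rw [Finset.sum_add_distrib, hlap, ← Finset.mul_sum]
      _ ≤ ‖M m g‖ * ‖M m (laplacianEnd A g)‖ + β * S := by
          refine add_le_add ?_ le_rfl
          exact (neg_le_abs _).trans ((RCLike.abs_re_le_norm _).trans (norm_inner_le_norm _ _))
      _ ≤ n * ‖M (m + 1) (laplacianEnd A g)‖ + β * S :=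
          add_le_add (mul_le_mul (hmono m g) (hmono m _) (norm_nonneg _) hn0) le_rfl
  -- Cauchy–Schwarz `S² ≤ d ∑ ‖M_m A_i g‖²`
  have hCS : S ^ 2 ≤ Fintype.card ι * ∑ i, ‖M m (A i g)‖ ^ 2 := by
    have := sq_sum_le_card_mul_sum_sq (s := Finset.univ) (f := fun i ↦ ‖M m (A i g)‖)
    simpa [Finset.card_univ] using this
  have hd0 : (0 : ℝ) ≤ Fintype.card ι := Nat.cast_nonneg _
  have hkey : S ^ 2 ≤ Fintype.card ι * (n * ‖M (m + 1) (laplacianEnd A g)‖) +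
      (Fintype.card ι * β) * S := by
    have := mul_le_mul_of_nonneg_left hQ hd0
    nlinarith
  have := le_sqrt_add_of_sq_le (by positivity) (by positivity) hkey
  calc S ≤ Real.sqrt (Fintype.card ι * (n * ‖M (m + 1) (laplacianEnd A g)‖)) +
        Fintype.card ι * β := this
    _ = _ := by rw [Real.sqrt_mul hd0, hβ, hn]; ring


/-! ## 3. Level sums of a solution and their scaled suprema -/

variable (A : ι → Module.End ℂ V) (M : ℕ → V →ₗ[ℂ] H) (f : V)

/-- The level sums `Σ_{j,k}(m) = ∑_{|α| = k} ‖M_m (A_α Δ^j f)‖` of `f`: all words of length `k`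
(indexed by `Fin k → ι`) applied to `Δ^j f`, measured with the weight of level `m`. [folklore] -/
def levelSum (j k m : ℕ) : ℝ :=
  ∑ w : Fin k → ι, ‖M m (wordEnd A (List.ofFn w) ((laplacianEnd A ^ j) f))‖

/-- The scaled suprema `Θ_{j,k} = sup_m Σ_{j,k}(m) / 2^{m (2j + k)}`: the quantity `A_α Δ^j f` of
total order `2j + k` is given the geometric weight `2^{-m (2j+k)}` at level `m` (the discrete form
of the weight `(R - r)^{2j+k}` on the ball of radius `r` in interior regularity). [folklore] -/
def scaledSup (j k : ℕ) : ℝ :=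
  ⨆ m : ℕ, levelSum A M f j k m / 2 ^ (m * (2 * j + k))

variable {A M f}

/-- `0 ≤ Σ_{j,k}(m)`. [folklore] -/
theorem levelSum_nonneg (j k m : ℕ) : 0 ≤ levelSum A M f j k m :=
  Finset.sum_nonneg fun _ _ ↦ norm_nonneg _

/-- `Σ_{0,0}(m) = ‖M_m f‖`. [folklore] -/
theorem levelSum_zero_zero (m : ℕ) : levelSum A M f 0 0 m = ‖M m f‖ := by
  simp [levelSum]

/-- The level sums are bounded in the level when every weight sequence `m ↦ ‖M_m v‖` is.
[folklore] -/
theorem exists_levelSum_le (hbdd : ∀ v : V, ∃ Λ : ℝ, ∀ m, ‖M m v‖ ≤ Λ) (j k : ℕ) :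
    ∃ Λ : ℝ, ∀ m, levelSum A M f j k m ≤ Λ := by
  classical
  choose Λ hΛ using hbdd
  exact ⟨∑ w : Fin k → ι, Λ (wordEnd A (List.ofFn w) ((laplacianEnd A ^ j) f)),
    fun m ↦ Finset.sum_le_sum fun w _ ↦ hΛ _ m⟩

/-- The scaled level sums are bounded above. [folklore] -/
theorem bddAbove_levelSum_div (hbdd : ∀ v : V, ∃ Λ : ℝ, ∀ m, ‖M m v‖ ≤ Λ) (j k : ℕ) :
    BddAbove (Set.range fun m : ℕ ↦ levelSum A M f j k m / 2 ^ (m * (2 * j + k))) := by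
  obtain ⟨Λ, hΛ⟩ := exists_levelSum_le (A := A) (f := f) hbdd j k
  refine ⟨max Λ 0, ?_⟩
  rintro _ ⟨m, rfl⟩
  have h1 : (1 : ℝ) ≤ 2 ^ (m * (2 * j + k)) := one_le_pow₀ (by norm_num)
  exact (div_le_self (levelSum_nonneg j k m) h1).trans ((hΛ m).trans (le_max_left _ _))

/-- `Σ_{j,k}(m) / 2^{m(2j+k)} ≤ Θ_{j,k}`. [folklore] -/
theorem levelSum_div_le_scaledSup (hbdd : ∀ v : V, ∃ Λ : ℝ, ∀ m, ‖M m v‖ ≤ Λ) (j k m : ℕ) :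
    levelSum A M f j k m / 2 ^ (m * (2 * j + k)) ≤ scaledSup A M f j k :=
  le_ciSup (bddAbove_levelSum_div hbdd j k) m

/-- `Σ_{j,k}(m) ≤ 2^{m(2j+k)} Θ_{j,k}`. [folklore] -/
theorem levelSum_le_mul_scaledSup (hbdd : ∀ v : V, ∃ Λ : ℝ, ∀ m, ‖M m v‖ ≤ Λ) (j k m : ℕ) :
    levelSum A M f j k m ≤ 2 ^ (m * (2 * j + k)) * scaledSup A M f j k := by
  have := levelSum_div_le_scaledSup (A := A) (f := f) hbdd j k m
  rwa [div_le_iff₀ (by positivity), mul_comm] at this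

/-- `0 ≤ Θ_{j,k}`. [folklore] -/
theorem scaledSup_nonneg (hbdd : ∀ v : V, ∃ Λ : ℝ, ∀ m, ‖M m v‖ ≤ Λ) (j k : ℕ) :
    0 ≤ scaledSup A M f j k :=
  le_trans (div_nonneg (levelSum_nonneg j k 0) (by positivity))
    (levelSum_div_le_scaledSup hbdd j k 0)

/-- `Θ_{j,k} ≤ B` as soon as every scaled level sum is `≤ B`. [folklore] -/
theorem scaledSup_le {j k : ℕ} {B : ℝ}
    (h : ∀ m, levelSum A M f j k m / 2 ^ (m * (2 * j + k)) ≤ B) : scaledSup A M f j k ≤ B :=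
  ciSup_le h

/-- `Θ_{0,0} ≤ a` when `‖M_m f‖ ≤ a` for all `m`. [folklore] -/
theorem scaledSup_zero_zero_le {a : ℝ} (ha : ∀ m, ‖M m f‖ ≤ a) : scaledSup A M f 0 0 ≤ a :=
  scaledSup_le fun m ↦ by simpa [levelSum_zero_zero] using ha m

/-- `Σ_{j+1,0}(m) ≤ Σ_{j,2}(m)`: `Δ^{j+1} f = ∑_i A_i A_i Δ^j f` is a sum of words of length `2`.
[folklore] -/
theorem levelSum_succ_zero_le (j m : ℕ) : levelSum A M f (j + 1) 0 m ≤ levelSum A M f j 2 m := by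
  classical
  set w₀ : V := (laplacianEnd A ^ j) f with hw₀
  have hL : levelSum A M f (j + 1) 0 m = ‖M m (laplacianEnd A w₀)‖ := by
    simp [levelSum, hw₀, pow_succ', Module.End.mul_apply]
  rw [hL, laplacianEnd_apply, map_sum]
  refine (norm_sum_le _ _).trans ?_
  -- the words `[i, i]`, an injective family of words of length `2`
  set e : ι → (Fin 2 → ι) := fun i _ ↦ i with he
  have hinj : Function.Injective e := fun i i' h ↦ by
    have := congr_fun h 0
    simpa [he] using this
  have hterm : ∀ i, ‖M m (A i (A i w₀))‖ =
      ‖M m (wordEnd A (List.ofFn (e i)) ((laplacianEnd A ^ j) f))‖ := by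
    intro i
    have : List.ofFn (e i) = [i, i] := by simp [he, List.ofFn_succ]
    rw [this, wordEnd_cons, wordEnd_singleton, Module.End.mul_apply]
  calc ∑ i, ‖M m (A i (A i w₀))‖
      = ∑ i, ‖M m (wordEnd A (List.ofFn (e i)) ((laplacianEnd A ^ j) f))‖ :=
        Finset.sum_congr rfl fun i _ ↦ hterm i
    _ = ∑ w ∈ Finset.univ.image e, ‖M m (wordEnd A (List.ofFn w) ((laplacianEnd A ^ j) f))‖ := by
        rw [Finset.sum_image fun i _ i' _ h ↦ hinj h]
    _ ≤ levelSum A M f j 2 m :=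
        Finset.sum_le_sum_of_subset_of_nonneg (Finset.subset_univ _) fun _ _ _ ↦ norm_nonneg _

/-- `Θ_{j+1,0} ≤ Θ_{j,2}` (same total order `2j + 2`). [folklore] -/
theorem scaledSup_succ_zero_le (hbdd : ∀ v : V, ∃ Λ : ℝ, ∀ m, ‖M m v‖ ≤ Λ) (j : ℕ) :
    scaledSup A M f (j + 1) 0 ≤ scaledSup A M f j 2 := by
  refine scaledSup_le fun m ↦ ?_
  have e : m * (2 * (j + 1) + 0) = m * (2 * j + 2) := by ring
  rw [e]
  exact (div_le_div_of_nonneg_right (levelSum_succ_zero_le j m) (by positivity)).trans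
    (levelSum_div_le_scaledSup hbdd j 2 m)

/-- **The closure at the top order.** If `Δ^{A₀} f = ∑_{i < A₀} r_i Δ^i f` (that is,
`R(Δ) f = 0` for the monic polynomial `R = X^{A₀} - ∑ r_i X^i`), then
`Σ_{A₀,k}(m) ≤ ∑_{i<A₀} |r_i| Σ_{i,k}(m)`. [folklore] -/
theorem levelSum_top_le {A₀ : ℕ} {r : ℕ → ℂ}
    (hR : (laplacianEnd A ^ A₀) f = ∑ i ∈ Finset.range A₀, r i • (laplacianEnd A ^ i) f)
    (k m : ℕ) :
    levelSum A M f A₀ k m ≤ ∑ i ∈ Finset.range A₀, ‖r i‖ * levelSum A M f i k m := by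
  unfold levelSum
  calc ∑ w : Fin k → ι, ‖M m (wordEnd A (List.ofFn w) ((laplacianEnd A ^ A₀) f))‖
      = ∑ w : Fin k → ι, ‖∑ i ∈ Finset.range A₀,
          r i • M m (wordEnd A (List.ofFn w) ((laplacianEnd A ^ i) f))‖ := by
        refine Finset.sum_congr rfl fun w _ ↦ ?_
        rw [hR, map_sum, map_sum]
        simp only [map_smul]
    _ ≤ ∑ w : Fin k → ι, ∑ i ∈ Finset.range A₀,
          ‖r i‖ * ‖M m (wordEnd A (List.ofFn w) ((laplacianEnd A ^ i) f))‖ := by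
        refine Finset.sum_le_sum fun w _ ↦ (norm_sum_le _ _).trans (Finset.sum_le_sum fun i _ ↦ ?_)
        rw [norm_smul]
    _ = ∑ i ∈ Finset.range A₀, ‖r i‖ *
          ∑ w : Fin k → ι, ‖M m (wordEnd A (List.ofFn w) ((laplacianEnd A ^ i) f))‖ := by
        rw [Finset.sum_comm]
        simp only [Finset.mul_sum]

/-- `Θ_{A₀,k} ≤ ∑_{i<A₀} |r_i| Θ_{i,k}` under `Δ^{A₀} f = ∑_{i<A₀} r_i Δ^i f` (the orders
`2i + k < 2A₀ + k` have larger weights). [folklore] -/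
theorem scaledSup_top_le (hbdd : ∀ v : V, ∃ Λ : ℝ, ∀ m, ‖M m v‖ ≤ Λ) {A₀ : ℕ} {r : ℕ → ℂ}
    (hR : (laplacianEnd A ^ A₀) f = ∑ i ∈ Finset.range A₀, r i • (laplacianEnd A ^ i) f)
    (k : ℕ) :
    scaledSup A M f A₀ k ≤ ∑ i ∈ Finset.range A₀, ‖r i‖ * scaledSup A M f i k := by
  refine scaledSup_le fun m ↦ ?_
  have hpos : (0 : ℝ) < 2 ^ (m * (2 * A₀ + k)) := by positivity
  rw [div_le_iff₀ hpos, Finset.sum_mul]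
  refine (levelSum_top_le hR k m).trans (Finset.sum_le_sum fun i hi ↦ ?_)
  rw [mul_assoc]
  refine mul_le_mul_of_nonneg_left ?_ (norm_nonneg _)
  have hi' : i < A₀ := Finset.mem_range.mp hi
  have hpow : (2 : ℝ) ^ (m * (2 * i + k)) ≤ 2 ^ (m * (2 * A₀ + k)) :=
    pow_le_pow_right₀ (by norm_num) (Nat.mul_le_mul_left m (by omega))
  calc levelSum A M f i k m ≤ 2 ^ (m * (2 * i + k)) * scaledSup A M f i k :=
        levelSum_le_mul_scaledSup hbdd i k m
    _ ≤ 2 ^ (m * (2 * A₀ + k)) * scaledSup A M f i k :=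
        mul_le_mul_of_nonneg_right hpow (scaledSup_nonneg hbdd i k)
    _ = scaledSup A M f i k * 2 ^ (m * (2 * A₀ + k)) := mul_comm _ _


/-! ## 4. The recursion for the level sums -/

/-- **The recursion (one more letter).** Under the hypotheses of `sum_norm_weight_apply_le` and
the commutator relations `[A_i, A_m] = ∑_l c_{iml} A_l`, `|c_{iml}| ≤ c`:
`Σ_{j,k+1}(m) ≤ √d √(Σ_{j,k}(m+1)) √(Σ_{j+1,k}(m+1) + 2k d^{k+2} c Σ_{j,k+1}(m+1)) + d D 2^m Σ_{j,k}(m+1)`.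
Indeed a word of length `k + 1` is `A_i A_α`, Caccioppoli applies to `g = A_α Δ^j f`, and
`Δ g = A_α Δ^{j+1} f + [Δ, A_α] Δ^j f` with `[Δ, A_α]` a sum of `2 k d²` words of length `k + 1`
(`norm_map_wordEnd_commLaplacianEnd_le`); then Cauchy–Schwarz over `α`. Nelson 1959, §6.
[folklore] -/
theorem levelSum_succ_le (A : ι → Module.End ℂ V) (c : ι → ι → ι → ℝ)
    (hbr : ∀ i m, A i * A m - A m * A i = ∑ l, (c i m l : ℂ) • A l) {cM : ℝ}
    (hc : ∀ i m l, |c i m l| ≤ cM) (M : ℕ → V →ₗ[ℂ] H)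
    (hmono : ∀ (m : ℕ) (v : V), ‖M m v‖ ≤ ‖M (m + 1) v‖) {D : ℝ} (hD : 0 ≤ D)
    (hskew : ∀ (m : ℕ) (i : ι) (u w : V),
      ‖⟪M m (A i u), M m w⟫_ℂ + ⟪M m u, M m (A i w)⟫_ℂ‖ ≤ D * 2 ^ m * ‖M (m + 1) u‖ * ‖M m w‖)
    (f : V) (j k m : ℕ) :
    levelSum A M f j (k + 1) m ≤
      Real.sqrt (Fintype.card ι) * Real.sqrt (levelSum A M f j k (m + 1)) *
          Real.sqrt (levelSum A M f (j + 1) k (m + 1) +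
            (2 * k * (Fintype.card ι : ℝ) ^ (k + 2) * cM) * levelSum A M f j (k + 1) (m + 1)) +
        Fintype.card ι * D * 2 ^ m * levelSum A M f j k (m + 1) := by
  classical
  set d : ℕ := Fintype.card ι with hd
  set w₀ : V := (laplacianEnd A ^ j) f with hw₀
  set x : ℝ := levelSum A M f j (k + 1) (m + 1) with hx
  -- the words of length `k`, and the three families of norms
  set g : (Fin k → ι) → V := fun w' ↦ wordEnd A (List.ofFn w') w₀ with hg
  set nrm : (Fin k → ι) → ℝ := fun w' ↦ ‖M (m + 1) (g w')‖ with hnrm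
  set lap : (Fin k → ι) → ℝ := fun w' ↦ ‖M (m + 1) (laplacianEnd A (g w'))‖ with hlap
  set nxt : (Fin k → ι) → ℝ :=
    fun w' ↦ ‖M (m + 1) (wordEnd A (List.ofFn w') ((laplacianEnd A ^ (j + 1)) f))‖ with hnxt
  have hx0 : 0 ≤ x := levelSum_nonneg _ _ _
  -- (i) re-index the words of length `k + 1` as `A_i A_α`
  have hsplit : levelSum A M f j (k + 1) m = ∑ w' : Fin k → ι, ∑ i, ‖M m (A i (g w'))‖ := by
    have h1 := Fintype.sum_equiv (Fin.consEquiv fun _ ↦ ι)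
      (fun p ↦ ‖M m (wordEnd A (List.ofFn (Fin.cons p.1 p.2 : Fin (k + 1) → ι)) w₀)‖)
      (fun w ↦ ‖M m (wordEnd A (List.ofFn w) w₀)‖) (fun _ ↦ rfl)
    unfold levelSum
    rw [← hw₀, ← h1, Fintype.sum_prod_type, Finset.sum_comm]
    refine Finset.sum_congr rfl fun w' _ ↦ Finset.sum_congr rfl fun i _ ↦ ?_
    have : List.ofFn (Fin.cons i w' : Fin (k + 1) → ι) = i :: List.ofFn w' := by
      rw [List.ofFn_succ]
      simp
    rw [this, wordEnd_cons, Module.End.mul_apply]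
  -- (ii) Caccioppoli for each word
  have hcacc : ∀ w', ∑ i, ‖M m (A i (g w'))‖ ≤
      Real.sqrt d * Real.sqrt (nrm w' * lap w') + d * D * 2 ^ m * nrm w' :=
    fun w' ↦ sum_norm_weight_apply_le A M hmono hD hskew m (g w')
  -- (iii) `Δ g = A_α Δ^{j+1} f + [Δ, A_α] Δ^j f`, the commutator being `2 k d²` words of length `k+1`
  have hcomm : ∀ w', lap w' ≤ nxt w' + 2 * k * (d : ℝ) ^ 2 * cM * x := by
    intro w'
    have hs : laplacianEnd A (g w') =
        wordEnd A (List.ofFn w') ((laplacianEnd A ^ (j + 1)) f) +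
          commLaplacianEnd A (List.ofFn w') w₀ := by
      have : (laplacianEnd A ^ (j + 1)) f = laplacianEnd A w₀ := by
        rw [pow_succ', Module.End.mul_apply]
      rw [this]
      simp [hg, commLaplacianEnd]
    have hxβ : ∀ β : List ι, β.length = (List.ofFn w').length + 1 →
        ‖M (m + 1) (wordEnd A ([] ++ β) w₀)‖ ≤ x := by
      intro β hβ
      have hβ' : β.length = k + 1 := by simpa using hβ
      set wβ : Fin (k + 1) → ι := fun i ↦ β.get (Fin.cast hβ'.symm i) with hwβ
      have hββ : List.ofFn wβ = β := by
        rw [hwβ, ← List.ofFn_congr hβ' β.get, List.ofFn_get]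
      rw [List.nil_append, ← hββ]
      exact Finset.single_le_sum (f := fun w : Fin (k + 1) → ι ↦
        ‖M (m + 1) (wordEnd A (List.ofFn w) ((laplacianEnd A ^ j) f))‖)
        (fun _ _ ↦ norm_nonneg _) (Finset.mem_univ wβ)
    have hcb := norm_map_wordEnd_commLaplacianEnd_le A c hbr hc (M (m + 1)) (List.ofFn w') [] w₀ hxβ
    simp only [wordEnd_nil, Module.End.one_apply, List.length_ofFn] at hcb
    calc lap w' = ‖M (m + 1) (laplacianEnd A (g w'))‖ := rfl
      _ ≤ nxt w' + ‖M (m + 1) (commLaplacianEnd A (List.ofFn w') w₀)‖ := by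
          rw [hs, map_add]; exact norm_add_le _ _
      _ ≤ nxt w' + 2 * k * (d : ℝ) ^ 2 * cM * x := add_le_add le_rfl hcb
  -- (iv) sum over the words and Cauchy–Schwarz
  have hnrm0 : ∀ w', 0 ≤ nrm w' := fun _ ↦ norm_nonneg _
  have hlap0 : ∀ w', 0 ≤ lap w' := fun _ ↦ norm_nonneg _
  have hsum_nrm : ∑ w', nrm w' = levelSum A M f j k (m + 1) := rfl
  have hsum_nxt : ∑ w', nxt w' = levelSum A M f (j + 1) k (m + 1) := rfl
  have hcard : (Fintype.card (Fin k → ι) : ℝ) = (d : ℝ) ^ k := by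
    rw [Fintype.card_fun, Fintype.card_fin]; push_cast; rfl
  have hsum_lap : ∑ w', lap w' ≤ levelSum A M f (j + 1) k (m + 1) +
      2 * k * (d : ℝ) ^ (k + 2) * cM * x := by
    calc ∑ w', lap w' ≤ ∑ w', (nxt w' + 2 * k * (d : ℝ) ^ 2 * cM * x) :=
          Finset.sum_le_sum fun w' _ ↦ hcomm w'
      _ = levelSum A M f (j + 1) k (m + 1) +
            (Fintype.card (Fin k → ι) : ℝ) * (2 * k * (d : ℝ) ^ 2 * cM * x) := by
          rw [Finset.sum_add_distrib, hsum_nxt, Finset.sum_const, Finset.card_univ, nsmul_eq_mul]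
      _ = _ := by rw [hcard]; ring
  calc levelSum A M f j (k + 1) m = ∑ w', ∑ i, ‖M m (A i (g w'))‖ := hsplit
    _ ≤ ∑ w', (Real.sqrt d * Real.sqrt (nrm w' * lap w') + d * D * 2 ^ m * nrm w') :=
        Finset.sum_le_sum fun w' _ ↦ hcacc w'
    _ = Real.sqrt d * ∑ w', Real.sqrt (nrm w') * Real.sqrt (lap w') +
          d * D * 2 ^ m * ∑ w', nrm w' := by
        rw [Finset.sum_add_distrib, Finset.mul_sum, Finset.mul_sum]
        refine congrArg₂ (· + ·) (Finset.sum_congr rfl fun w' _ ↦ ?_) rfl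
        rw [Real.sqrt_mul (hnrm0 w')]
    _ ≤ Real.sqrt d * (Real.sqrt (∑ w', nrm w') * Real.sqrt (∑ w', lap w')) +
          d * D * 2 ^ m * ∑ w', nrm w' :=
        add_le_add (mul_le_mul_of_nonneg_left
          (Real.sum_sqrt_mul_sqrt_le _ hnrm0 hlap0) (Real.sqrt_nonneg _)) le_rfl
    _ ≤ _ := by
        rw [hsum_nrm, ← mul_assoc]
        refine add_le_add (mul_le_mul_of_nonneg_left (Real.sqrt_le_sqrt hsum_lap) ?_) le_rfl
        exact mul_nonneg (Real.sqrt_nonneg _) (Real.sqrt_nonneg _)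


/-- The real-variable form of one level of the recursion: homogeneity of the geometric weights.
[folklore] -/
theorem stepA_real {L₀ L₁ L₂ Lm Θ₀ Θ₁ Θ₂ P Q T d D C₁ : ℝ} (hP : 0 < P) (hQ : 0 < Q)
    (hT : 1 ≤ T) (hd : 0 ≤ d) (hD : 0 ≤ D) (hC₁ : 0 ≤ C₁) (hΘ₁ : 0 ≤ Θ₁) (hΘ₂ : 0 ≤ Θ₂)
    (h0 : L₀ ≤ P * Q * Θ₀) (h1 : L₁ ≤ P * Q * (4 * T ^ 2) * Θ₁) (h2 : L₂ ≤ P * Q * (2 * T) * Θ₂)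
    (hstar : Lm ≤ Real.sqrt d * Real.sqrt L₀ * Real.sqrt (L₁ + C₁ * L₂) + d * D * T * L₀) :
    Lm / (P * T) ≤
      Q * (Real.sqrt d * Real.sqrt Θ₀ * Real.sqrt (4 * Θ₁ + 2 * C₁ * Θ₂) + d * D * Θ₀) := by
  have hT0 : 0 ≤ T := zero_le_one.trans hT
  have hPQ0 : 0 ≤ P * Q := by positivity
  set Y : ℝ := 4 * Θ₁ + 2 * C₁ * Θ₂ with hY
  have hY0 : 0 ≤ Y := by rw [hY]; positivity
  have hB1 : Real.sqrt L₀ ≤ Real.sqrt (P * Q) * Real.sqrt Θ₀ := by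
    rw [← Real.sqrt_mul hPQ0]
    exact Real.sqrt_le_sqrt h0
  have hB2 : Real.sqrt (L₁ + C₁ * L₂) ≤ Real.sqrt (P * Q) * T * Real.sqrt Y := by
    have hle : L₁ + C₁ * L₂ ≤ (P * Q * T ^ 2) * Y := by
      have h2' : C₁ * L₂ ≤ C₁ * (P * Q * (2 * T) * Θ₂) := mul_le_mul_of_nonneg_left h2 hC₁
      have hTT : T ≤ T ^ 2 := by nlinarith
      have h2'' : C₁ * (P * Q * (2 * T) * Θ₂) ≤ C₁ * (P * Q * (2 * T ^ 2) * Θ₂) := by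
        refine mul_le_mul_of_nonneg_left (mul_le_mul_of_nonneg_right ?_ hΘ₂) hC₁
        exact mul_le_mul_of_nonneg_left (by linarith) hPQ0
      rw [hY]
      nlinarith
    calc _ ≤ Real.sqrt ((P * Q * T ^ 2) * Y) := Real.sqrt_le_sqrt hle
      _ = Real.sqrt (P * Q) * T * Real.sqrt Y := by
          rw [Real.sqrt_mul (by positivity), Real.sqrt_mul hPQ0, Real.sqrt_sq hT0]
  have hsq : Real.sqrt (P * Q) * Real.sqrt (P * Q) = P * Q := Real.mul_self_sqrt hPQ0
  have hmain : Lm ≤ P * T * (Q * (Real.sqrt d * Real.sqrt Θ₀ * Real.sqrt Y + d * D * Θ₀)) := by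
    calc Lm ≤ Real.sqrt d * Real.sqrt L₀ * Real.sqrt (L₁ + C₁ * L₂) + d * D * T * L₀ := hstar
      _ ≤ Real.sqrt d * (Real.sqrt (P * Q) * Real.sqrt Θ₀) * (Real.sqrt (P * Q) * T * Real.sqrt Y) +
          d * D * T * (P * Q * Θ₀) := by
          refine add_le_add ?_ (mul_le_mul_of_nonneg_left h0 (by positivity))
          exact mul_le_mul (mul_le_mul_of_nonneg_left hB1 (Real.sqrt_nonneg _)) hB2
            (Real.sqrt_nonneg _) (by positivity)
      _ = P * T * (Q * (Real.sqrt d * Real.sqrt Θ₀ * Real.sqrt Y + d * D * Θ₀)) := by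
          have : Real.sqrt d * (Real.sqrt (P * Q) * Real.sqrt Θ₀) *
              (Real.sqrt (P * Q) * T * Real.sqrt Y) =
              (Real.sqrt (P * Q) * Real.sqrt (P * Q)) * T *
                (Real.sqrt d * Real.sqrt Θ₀ * Real.sqrt Y) := by ring
          rw [this, hsq]
          ring
  rw [div_le_iff₀ (by positivity)]
  calc Lm ≤ _ := hmain
    _ = _ := by ring

/-- The real-variable form of the absorption: if `Θ₂ ≤ Q (√d √Θ₀ √(4Θ₁ + 2C₁Θ₂) + d D Θ₀)`
with everything nonnegative (and finite), then
`Θ₂ ≤ 4 Q √d √(Θ₀ Θ₁) + (2 Q² d C₁ + 2 Q d D) Θ₀` (arithmetic–geometric mean). [folklore] -/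
theorem absorb_real {Θ₀ Θ₁ Θ₂ Q d D C₁ : ℝ} (hQ : 0 ≤ Q) (hd : 0 ≤ d) (hC₁ : 0 ≤ C₁)
    (hΘ₀ : 0 ≤ Θ₀) (hΘ₁ : 0 ≤ Θ₁) (hΘ₂ : 0 ≤ Θ₂)
    (h : Θ₂ ≤ Q * (Real.sqrt d * Real.sqrt Θ₀ * Real.sqrt (4 * Θ₁ + 2 * C₁ * Θ₂) + d * D * Θ₀)) :
    Θ₂ ≤ 4 * Q * Real.sqrt d * Real.sqrt (Θ₀ * Θ₁) + (2 * Q ^ 2 * d * C₁ + 2 * Q * d * D) * Θ₀ := by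
  have h2C : 0 ≤ 2 * C₁ * Θ₂ := by positivity
  have hsqY : Real.sqrt (4 * Θ₁ + 2 * C₁ * Θ₂) ≤ 2 * Real.sqrt Θ₁ + Real.sqrt (2 * C₁ * Θ₂) := by
    have h0 : 0 ≤ 2 * Real.sqrt Θ₁ + Real.sqrt (2 * C₁ * Θ₂) := by positivity
    calc Real.sqrt (4 * Θ₁ + 2 * C₁ * Θ₂)
        ≤ Real.sqrt ((2 * Real.sqrt Θ₁ + Real.sqrt (2 * C₁ * Θ₂)) ^ 2) := by
          refine Real.sqrt_le_sqrt ?_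
          nlinarith [Real.sq_sqrt hΘ₁, Real.sq_sqrt h2C,
            mul_nonneg (Real.sqrt_nonneg Θ₁) (Real.sqrt_nonneg (2 * C₁ * Θ₂))]
      _ = _ := Real.sqrt_sq h0
  have hmid : Q * Real.sqrt d * Real.sqrt Θ₀ * Real.sqrt (2 * C₁ * Θ₂) ≤
      Θ₂ / 2 + Q ^ 2 * d * C₁ * Θ₀ := by
    set a : ℝ := Real.sqrt Θ₂ with ha
    set b : ℝ := Q * Real.sqrt d * Real.sqrt (2 * C₁) * Real.sqrt Θ₀ with hb
    have hab : a * b ≤ (a ^ 2 + b ^ 2) / 2 := by nlinarith [sq_nonneg (a - b)]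
    have ha2 : a ^ 2 = Θ₂ := Real.sq_sqrt hΘ₂
    have h2C' : (0 : ℝ) ≤ 2 * C₁ := by positivity
    have hb2 : b ^ 2 = Q ^ 2 * d * (2 * C₁) * Θ₀ := by
      rw [hb, mul_pow, mul_pow, mul_pow, Real.sq_sqrt hd, Real.sq_sqrt h2C', Real.sq_sqrt hΘ₀]
    have hlhs : Q * Real.sqrt d * Real.sqrt Θ₀ * Real.sqrt (2 * C₁ * Θ₂) = a * b := by
      rw [Real.sqrt_mul h2C' Θ₂, ha, hb]
      ring
    rw [hlhs]
    calc a * b ≤ (a ^ 2 + b ^ 2) / 2 := hab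
      _ = Θ₂ / 2 + Q ^ 2 * d * C₁ * Θ₀ := by rw [ha2, hb2]; ring
  have hsd : 0 ≤ Q * (Real.sqrt d * Real.sqrt Θ₀) := by positivity
  have hfin : Θ₂ ≤ 2 * Q * Real.sqrt d * Real.sqrt (Θ₀ * Θ₁) + Θ₂ / 2 +
      Q ^ 2 * d * C₁ * Θ₀ + Q * d * D * Θ₀ := by
    calc Θ₂ ≤ Q * (Real.sqrt d * Real.sqrt Θ₀ * Real.sqrt (4 * Θ₁ + 2 * C₁ * Θ₂) + d * D * Θ₀) := h
      _ ≤ Q * (Real.sqrt d * Real.sqrt Θ₀ * (2 * Real.sqrt Θ₁ + Real.sqrt (2 * C₁ * Θ₂)) +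
            d * D * Θ₀) :=
          mul_le_mul_of_nonneg_left (add_le_add (mul_le_mul_of_nonneg_left hsqY
            (mul_nonneg (Real.sqrt_nonneg _) (Real.sqrt_nonneg _))) le_rfl) hQ
      _ = 2 * Q * Real.sqrt d * (Real.sqrt Θ₀ * Real.sqrt Θ₁) +
            Q * Real.sqrt d * Real.sqrt Θ₀ * Real.sqrt (2 * C₁ * Θ₂) + Q * d * D * Θ₀ := by ring
      _ ≤ 2 * Q * Real.sqrt d * (Real.sqrt Θ₀ * Real.sqrt Θ₁) +
            (Θ₂ / 2 + Q ^ 2 * d * C₁ * Θ₀) + Q * d * D * Θ₀ :=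
          add_le_add (add_le_add le_rfl hmid) le_rfl
      _ = _ := by rw [← Real.sqrt_mul hΘ₀]; ring
  linarith

/-- **The recursion for the scaled suprema (one more letter), after absorption.** With
`Q = 2^{2j+k}`, `C₁ = 2k d^{k+2} c`:
`Θ_{j,k+1} ≤ 4 Q √d √(Θ_{j,k} Θ_{j+1,k}) + (2 Q² d C₁ + 2 Q d D) Θ_{j,k}`.
From `levelSum_succ_le` at level `m`, the geometric weights make every term homogeneous
(`Σ_{j,k}(m+1) ≤ 2^{(m+1)(2j+k)} Θ_{j,k}` etc., `stepA_real`), whence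
`Θ_{j,k+1} ≤ Q (√d √Θ_{j,k} √(4 Θ_{j+1,k} + 2 C₁ Θ_{j,k+1}) + d D Θ_{j,k})`, and the finite
quantity `Θ_{j,k+1}` on the right is absorbed (`absorb_real`). This is the interpolation step of
interior regularity. [folklore] -/
theorem scaledSup_succ_le (A : ι → Module.End ℂ V) (c : ι → ι → ι → ℝ)
    (hbr : ∀ i m, A i * A m - A m * A i = ∑ l, (c i m l : ℂ) • A l) {cM : ℝ} (hcM : 0 ≤ cM)
    (hc : ∀ i m l, |c i m l| ≤ cM) (M : ℕ → V →ₗ[ℂ] H)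
    (hmono : ∀ (m : ℕ) (v : V), ‖M m v‖ ≤ ‖M (m + 1) v‖) {D : ℝ} (hD : 0 ≤ D)
    (hskew : ∀ (m : ℕ) (i : ι) (u w : V),
      ‖⟪M m (A i u), M m w⟫_ℂ + ⟪M m u, M m (A i w)⟫_ℂ‖ ≤ D * 2 ^ m * ‖M (m + 1) u‖ * ‖M m w‖)
    (hbdd : ∀ v : V, ∃ Λ : ℝ, ∀ m, ‖M m v‖ ≤ Λ) (f : V) (j k : ℕ) :
    scaledSup A M f j (k + 1) ≤
      4 * 2 ^ (2 * j + k) * Real.sqrt (Fintype.card ι) *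
          Real.sqrt (scaledSup A M f j k * scaledSup A M f (j + 1) k) +
        (2 * ((2 : ℝ) ^ (2 * j + k)) ^ 2 * Fintype.card ι *
            (2 * k * (Fintype.card ι : ℝ) ^ (k + 2) * cM) +
          2 * 2 ^ (2 * j + k) * Fintype.card ι * D) * scaledSup A M f j k := by
  have hΘ₀ : 0 ≤ scaledSup A M f j k := scaledSup_nonneg hbdd j k
  have hΘ₁ : 0 ≤ scaledSup A M f (j + 1) k := scaledSup_nonneg hbdd (j + 1) k
  have hΘ₂ : 0 ≤ scaledSup A M f j (k + 1) := scaledSup_nonneg hbdd j (k + 1)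
  have hQ0 : (0 : ℝ) < (2 : ℝ) ^ (2 * j + k) := by positivity
  have hC₁0 : 0 ≤ 2 * k * (Fintype.card ι : ℝ) ^ (k + 2) * cM := by positivity
  have hd0 : (0 : ℝ) ≤ Fintype.card ι := Nat.cast_nonneg _
  -- Steps A and B: the bound at each level, then the supremum
  have hB : scaledSup A M f j (k + 1) ≤ (2 : ℝ) ^ (2 * j + k) *
      (Real.sqrt (Fintype.card ι) * Real.sqrt (scaledSup A M f j k) *
        Real.sqrt (4 * scaledSup A M f (j + 1) k +
          2 * (2 * k * (Fintype.card ι : ℝ) ^ (k + 2) * cM) * scaledSup A M f j (k + 1)) +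
        Fintype.card ι * D * scaledSup A M f j k) := by
    refine scaledSup_le fun m ↦ ?_
    have e0 : (2 : ℝ) ^ ((m + 1) * (2 * j + k)) = 2 ^ (m * (2 * j + k)) * 2 ^ (2 * j + k) := by
      rw [← pow_add]; congr 1; ring
    have e1 : (2 : ℝ) ^ ((m + 1) * (2 * (j + 1) + k)) =
        2 ^ (m * (2 * j + k)) * 2 ^ (2 * j + k) * (4 * ((2 : ℝ) ^ m) ^ 2) := by
      have : (m + 1) * (2 * (j + 1) + k) = m * (2 * j + k) + (2 * j + k) + (m + m + 2) := by ring
      rw [this, pow_add, pow_add, pow_add, pow_add]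
      ring
    have e2 : (2 : ℝ) ^ ((m + 1) * (2 * j + (k + 1))) =
        2 ^ (m * (2 * j + k)) * 2 ^ (2 * j + k) * (2 * (2 : ℝ) ^ m) := by
      have : (m + 1) * (2 * j + (k + 1)) = m * (2 * j + k) + (2 * j + k) + (m + 1) := by ring
      rw [this, pow_add, pow_add, pow_succ]
      ring
    have em : (2 : ℝ) ^ (m * (2 * j + (k + 1))) = 2 ^ (m * (2 * j + k)) * (2 : ℝ) ^ m := by
      have : m * (2 * j + (k + 1)) = m * (2 * j + k) + m := by ring
      rw [this, pow_add]
    have h0 := levelSum_le_mul_scaledSup (A := A) (f := f) hbdd j k (m + 1)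
    rw [e0] at h0
    have h1 := levelSum_le_mul_scaledSup (A := A) (f := f) hbdd (j + 1) k (m + 1)
    rw [e1] at h1
    have h2 := levelSum_le_mul_scaledSup (A := A) (f := f) hbdd j (k + 1) (m + 1)
    rw [e2] at h2
    have hstar := levelSum_succ_le A c hbr hc M hmono hD hskew f j k m
    rw [em]
    exact stepA_real (by positivity) hQ0 (one_le_pow₀ (by norm_num)) hd0 hD hC₁0 hΘ₁ hΘ₂
      h0 h1 h2 hstar
  exact absorb_real hQ0.le hd0 hC₁0 hΘ₀ hΘ₁ hΘ₂ hB


/-! ## 5. The interior estimate -/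

/-- The constant of the chain of inequalities fed to the closing lemma: with `E = 2A₀ + k_max`,
`4·2^E √d √(1 ⊔ r A₀) + 2·4^E d (2 k_max d^{k_max+2} c) + 2·2^E d D + 1`. [folklore] -/
def chainConst (d : ℕ) (cM D : ℝ) (A₀ : ℕ) (rM : ℝ) (kmax : ℕ) : ℝ :=
  4 * 2 ^ (2 * A₀ + kmax) * Real.sqrt d * Real.sqrt (max 1 (rM * A₀)) +
    (2 * ((2 : ℝ) ^ (2 * A₀ + kmax)) ^ 2 * d * (2 * kmax * (d : ℝ) ^ (kmax + 2) * cM) +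
      2 * 2 ^ (2 * A₀ + kmax) * d * D) + 1

/-- `1 ≤ chainConst`. [folklore] -/
theorem one_le_chainConst {d : ℕ} {cM D : ℝ} (hcM : 0 ≤ cM) (hD : 0 ≤ D) (A₀ : ℕ) (rM : ℝ)
    (kmax : ℕ) : 1 ≤ chainConst d cM D A₀ rM kmax :=
  le_add_of_nonneg_left (by positivity)

/-- **The constant of the interior estimate**, `2 L_C(A₀ (k_max + 1), 1/2)` with `C = chainConst`:
it depends only on the number of operators `d`, the bound `c` on the structure constants, the
defect constant `D` of the weights, the degree `A₀` and the coefficient bound `r` of the equation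
`R(Δ) f = 0`, and the number `k_max` of derivatives estimated. [folklore] -/
def interiorConst (d : ℕ) (cM D : ℝ) (A₀ : ℕ) (rM : ℝ) (kmax : ℕ) : ℝ :=
  2 * closingL (chainConst d cM D A₀ rM kmax) (A₀ * (kmax + 1)) (1 / 2)

/-- **Nelson's interior estimate for solutions of `R(Δ) f = 0` (sum-of-squares recursion with
absorption).** Let `(A_i)_{i ∈ ι}` be finitely many operators on a complex vector space `V`,
closed under commutators with real structure constants bounded by `c`, `Δ = ∑ A_i²`; let
`M_m : V → H` (`m ∈ ℕ`) be linear weights into an inner product space, monotone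
(`‖M_m v‖ ≤ ‖M_{m+1} v‖`), pointwise bounded (`sup_m ‖M_m v‖ < ∞`) and almost skew with geometric
defect (`|⟪M_m A_i u, M_m w⟫ + ⟪M_m u, M_m A_i w⟫| ≤ D 2^m ‖M_{m+1} u‖ ‖M_m w‖`). If
`Δ^{A₀} f = ∑_{i<A₀} r_i Δ^i f` (`A₀ ≥ 1`, `|r_i| ≤ r`) and `‖M_m f‖ ≤ a` for all `m`, then for
every `k ≤ k_max` (`k_max ≥ 2`)

  `∑_{|α| = k} ‖M_0 (A_α f)‖ ≤ interiorConst(d, c, D, A₀, r, k_max) · a`.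

In the application (`Literature/NumberTheory/Automorphic`): `V` = smooth functions on a Lie group
orbit, `A_i` = left-invariant vector fields of a basis, `M_m` = multiplication by a smooth cut-off
between the balls of radii `s_m ↑ S` (slope `≲ 2^m`) composed with the orbit map into `L²`, `f` a
`K`-finite `Z(𝔤)`-finite function (so that `R(Δ) f = 0` for Nelson's Laplacian `Δ` and a
polynomial `R`): all derivatives of `f` on the half ball are square integrable with norms bounded
by the `L²`-norm of `f` on the full ball — interior elliptic regularity for `R(Δ)`, obtained by
integration by parts alone. Proof: `scaledSup_succ_le`, `scaledSup_succ_zero_le` and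
`scaledSup_top_le` feed the closing lemma on the finite family `Θ_{j,k}`, `j < A₀`, `k ≤ k_max`.
Nelson 1959, §6; Gaffney 1954 (cut-offs); the absorption is the classical interior-regularity
argument (e.g. Nirenberg 1955, Friedrichs 1953) specialised to polynomials in a sum of squares.
[folklore] -/
theorem sum_norm_weight_wordEnd_le_interiorConst (A : ι → Module.End ℂ V) (c : ι → ι → ι → ℝ)
    (hbr : ∀ i m, A i * A m - A m * A i = ∑ l, (c i m l : ℂ) • A l) {cM : ℝ} (hcM : 0 ≤ cM)
    (hc : ∀ i m l, |c i m l| ≤ cM) (M : ℕ → V →ₗ[ℂ] H)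
    (hmono : ∀ (m : ℕ) (v : V), ‖M m v‖ ≤ ‖M (m + 1) v‖) {D : ℝ} (hD : 0 ≤ D)
    (hskew : ∀ (m : ℕ) (i : ι) (u w : V),
      ‖⟪M m (A i u), M m w⟫_ℂ + ⟪M m u, M m (A i w)⟫_ℂ‖ ≤ D * 2 ^ m * ‖M (m + 1) u‖ * ‖M m w‖)
    (hbdd : ∀ v : V, ∃ Λ : ℝ, ∀ m, ‖M m v‖ ≤ Λ)
    {A₀ : ℕ} (hA₀ : 1 ≤ A₀) {r : ℕ → ℂ} {rM : ℝ} (hrM : 0 ≤ rM) (hr : ∀ i < A₀, ‖r i‖ ≤ rM)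
    {f : V} (hR : (laplacianEnd A ^ A₀) f = ∑ i ∈ Finset.range A₀, r i • (laplacianEnd A ^ i) f)
    {a : ℝ} (ha : ∀ m, ‖M m f‖ ≤ a) {kmax : ℕ} (hkmax : 2 ≤ kmax) {k : ℕ} (hk : k ≤ kmax) :
    ∑ w : Fin k → ι, ‖M 0 (wordEnd A (List.ofFn w) f)‖ ≤
      interiorConst (Fintype.card ι) cM D A₀ rM kmax * a := by
  classical
  set d : ℕ := Fintype.card ι with hd
  set C : ℝ := chainConst d cM D A₀ rM kmax with hCdef
  have hC1 : 1 ≤ C := one_le_chainConst hcM hD A₀ rM kmax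
  have ha0 : 0 ≤ a := (norm_nonneg _).trans (ha 0)
  -- the finite family `Θ_{j,k}`, `j < A₀`, `k ≤ kmax`, ranked by `j (kmax + 1) + k`
  set u : Fin A₀ × Fin (kmax + 1) → ℝ := fun x ↦ scaledSup A M f x.1 x.2 with hu
  set rank : Fin A₀ × Fin (kmax + 1) → ℕ := fun x ↦ (x.1 : ℕ) * (kmax + 1) + x.2 with hrank
  haveI : Nonempty (Fin A₀ × Fin (kmax + 1)) := ⟨(⟨0, hA₀⟩, 0)⟩
  set U : ℝ := Finset.univ.sup' Finset.univ_nonempty u with hUdef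
  have hu0 : ∀ x, 0 ≤ u x := fun x ↦ scaledSup_nonneg hbdd _ _
  have huU : ∀ x, u x ≤ U := fun x ↦ Finset.le_sup' u (Finset.mem_univ x)
  have hmax : ∃ x, U ≤ u x := by
    obtain ⟨x, _, hx⟩ := Finset.exists_mem_eq_sup' Finset.univ_nonempty u
    exact ⟨x, hx.le⟩
  have hU0 : 0 ≤ U := (hu0 _).trans (huU (⟨0, hA₀⟩, 0))
  have hn : ∀ x, rank x ≤ A₀ * (kmax + 1) := by
    intro x
    have h1 : (x.1 : ℕ) + 1 ≤ A₀ := x.1.2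
    have h2 : (x.2 : ℕ) ≤ kmax := Nat.lt_succ_iff.mp x.2.2
    calc rank x = x.1 * (kmax + 1) + x.2 := rfl
      _ ≤ x.1 * (kmax + 1) + (kmax + 1) := by omega
      _ = (x.1 + 1) * (kmax + 1) := by ring
      _ ≤ A₀ * (kmax + 1) := Nat.mul_le_mul_right _ h1
  have hroot : ∀ x, rank x = 0 → u x ≤ a := by
    intro x hx
    have h1 : (x.1 : ℕ) * (kmax + 1) = 0 ∧ (x.2 : ℕ) = 0 := Nat.add_eq_zero_iff.mp hx
    have h2 : (x.1 : ℕ) = 0 := by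
      rcases Nat.mul_eq_zero.mp h1.1 with h | h
      · exact h
      · omega
    have : u x = scaledSup A M f 0 0 := by
      simp only [hu]
      rw [h2, h1.2]
    rw [this]
    exact scaledSup_zero_zero_le ha
  -- bounds on the partner `Θ_{j+1,k}`
  have hplus : ∀ (j' : Fin A₀) (k' : Fin (kmax + 1)),
      scaledSup A M f (j' + 1) k' ≤ max 1 (rM * A₀) * U := by
    intro j' k'
    by_cases hjA : (j' : ℕ) + 1 < A₀
    · calc scaledSup A M f (j' + 1) k' = u (⟨j' + 1, hjA⟩, k') := rfl
        _ ≤ U := huU _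
        _ ≤ max 1 (rM * A₀) * U := le_mul_of_one_le_left hU0 (le_max_left _ _)
    · have hjeq : (j' : ℕ) + 1 = A₀ := by have := j'.2; omega
      rw [hjeq]
      calc scaledSup A M f A₀ k' ≤ ∑ i ∈ Finset.range A₀, ‖r i‖ * scaledSup A M f i k' :=
            scaledSup_top_le hbdd hR k'
        _ ≤ ∑ i ∈ Finset.range A₀, rM * U := by
            refine Finset.sum_le_sum fun i hi ↦ ?_
            have hi' : i < A₀ := Finset.mem_range.mp hi
            exact mul_le_mul (hr i hi') (huU (⟨i, hi'⟩, k')) (scaledSup_nonneg hbdd _ _) hrM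
        _ = rM * A₀ * U := by
            rw [Finset.sum_const, Finset.card_range, nsmul_eq_mul]; ring
        _ ≤ max 1 (rM * A₀) * U := mul_le_mul_of_nonneg_right (le_max_right _ _) hU0
  -- the chain inequalities
  have hstep : ∀ x, rank x ≠ 0 → ∃ y, rank y < rank x ∧ u x ≤ C * (Real.sqrt (u y * U) + u y) := by
    rintro ⟨j', k'⟩ hx
    by_cases hk' : (k' : ℕ) = 0
    · -- a `j`-step: `Θ_{j+1,0} ≤ Θ_{j,2}`
      have hj' : (j' : ℕ) ≠ 0 := by
        intro h
        apply hx
        simp only [hrank, h, hk', zero_mul, zero_add]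
      obtain ⟨j, hj⟩ := Nat.exists_eq_succ_of_ne_zero hj'
      have hjA : j < A₀ := by have := j'.2; omega
      have h2k : 2 < kmax + 1 := by omega
      refine ⟨(⟨j, hjA⟩, ⟨2, h2k⟩), ?_, ?_⟩
      · show j * (kmax + 1) + 2 < (j' : ℕ) * (kmax + 1) + k'
        have : (j + 1) * (kmax + 1) = j * (kmax + 1) + (kmax + 1) := by ring
        rw [hj, hk', this]
        omega
      · have hle : u (j', k') ≤ u (⟨j, hjA⟩, ⟨2, h2k⟩) := by
          show scaledSup A M f j' k' ≤ scaledSup A M f j 2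
          rw [hj, hk']
          exact scaledSup_succ_zero_le hbdd j
        have hy0 := hu0 (⟨j, hjA⟩, ⟨2, h2k⟩)
        have hs0 := Real.sqrt_nonneg (u (⟨j, hjA⟩, ⟨2, h2k⟩) * U)
        nlinarith
    · -- a `k`-step: `scaledSup_succ_le`
      obtain ⟨k, hkk⟩ := Nat.exists_eq_succ_of_ne_zero hk'
      have hkK : k < kmax + 1 := by have := k'.2; omega
      have hkle : k ≤ kmax := by omega
      refine ⟨(j', ⟨k, hkK⟩), ?_, ?_⟩
      · show (j' : ℕ) * (kmax + 1) + k < (j' : ℕ) * (kmax + 1) + k'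
        omega
      · have hss := scaledSup_succ_le A c hbr hcM hc M hmono hD hskew hbdd f j' k
        set Θ₀ : ℝ := scaledSup A M f j' k with hΘ₀
        have hΘ₀0 : 0 ≤ Θ₀ := scaledSup_nonneg hbdd _ _
        have huy : u (j', ⟨k, hkK⟩) = Θ₀ := rfl
        have hux : u (j', k') = scaledSup A M f j' (k + 1) := by
          show scaledSup A M f j' k' = _
          rw [hkk]
        have hΘ₁ : scaledSup A M f (j' + 1) k ≤ max 1 (rM * A₀) * U := hplus j' ⟨k, hkK⟩
        have hΘ₁0 : 0 ≤ scaledSup A M f (j' + 1) k := scaledSup_nonneg hbdd _ _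
        -- compare the constants with `chainConst`
        have hE : 2 * (j' : ℕ) + k ≤ 2 * A₀ + kmax := by have := j'.2; omega
        have hQ : (2 : ℝ) ^ (2 * (j' : ℕ) + k) ≤ 2 ^ (2 * A₀ + kmax) :=
          pow_le_pow_right₀ one_le_two hE
        have hQ0 : (0 : ℝ) ≤ (2 : ℝ) ^ (2 * (j' : ℕ) + k) := by positivity
        have hd0 : (0 : ℝ) ≤ d := Nat.cast_nonneg _
        have hC₁ : 2 * (k : ℝ) * (d : ℝ) ^ (k + 2) * cM ≤ 2 * kmax * (d : ℝ) ^ (kmax + 2) * cM := by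
          have hk_le : (k : ℝ) ≤ kmax := by exact_mod_cast hkle
          have hdpow : (d : ℝ) ^ (k + 2) ≤ (d : ℝ) ^ (kmax + 2) := by
            rcases Nat.eq_zero_or_pos d with hd0' | hdpos
            · simp [hd0']
            · exact pow_le_pow_right₀ (by exact_mod_cast hdpos) (by omega)
          refine mul_le_mul_of_nonneg_right ?_ hcM
          exact mul_le_mul (mul_le_mul_of_nonneg_left hk_le zero_le_two) hdpow (by positivity)
            (by positivity)
        have hC₁0 : 0 ≤ 2 * (k : ℝ) * (d : ℝ) ^ (k + 2) * cM := by positivity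
        -- the square-root piece
        set S₁ : ℝ := 4 * 2 ^ (2 * A₀ + kmax) * Real.sqrt d * Real.sqrt (max 1 (rM * A₀)) with hS₁
        set S₂ : ℝ := 2 * ((2 : ℝ) ^ (2 * A₀ + kmax)) ^ 2 * d * (2 * kmax * (d : ℝ) ^ (kmax + 2) * cM) +
          2 * 2 ^ (2 * A₀ + kmax) * d * D with hS₂
        have hS₁0 : 0 ≤ S₁ := by positivity
        have hS₂0 : 0 ≤ S₂ := by positivity
        have hCS : C = S₁ + S₂ + 1 := rfl
        have hmax0 : 0 ≤ max 1 (rM * A₀) := zero_le_one.trans (le_max_left _ _)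
        have hsq : 4 * 2 ^ (2 * (j' : ℕ) + k) * Real.sqrt d *
            Real.sqrt (Θ₀ * scaledSup A M f (j' + 1) k) ≤ S₁ * Real.sqrt (Θ₀ * U) := by
          have h1 : Real.sqrt (Θ₀ * scaledSup A M f (j' + 1) k) ≤
              Real.sqrt (max 1 (rM * A₀)) * Real.sqrt (Θ₀ * U) := by
            rw [← Real.sqrt_mul hmax0]
            refine Real.sqrt_le_sqrt ?_
            calc Θ₀ * scaledSup A M f (j' + 1) k ≤ Θ₀ * (max 1 (rM * A₀) * U) :=
                mul_le_mul_of_nonneg_left hΘ₁ hΘ₀0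
              _ = max 1 (rM * A₀) * (Θ₀ * U) := by ring
          calc 4 * 2 ^ (2 * (j' : ℕ) + k) * Real.sqrt d * Real.sqrt (Θ₀ * scaledSup A M f (j' + 1) k)
              ≤ 4 * 2 ^ (2 * A₀ + kmax) * Real.sqrt d *
                  (Real.sqrt (max 1 (rM * A₀)) * Real.sqrt (Θ₀ * U)) :=
                mul_le_mul (mul_le_mul_of_nonneg_right (mul_le_mul_of_nonneg_left hQ (by norm_num))
                  (Real.sqrt_nonneg _)) h1 (Real.sqrt_nonneg _) (by positivity)
            _ = S₁ * Real.sqrt (Θ₀ * U) := by rw [hS₁]; ring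
        -- the linear piece
        have hlin : (2 * ((2 : ℝ) ^ (2 * (j' : ℕ) + k)) ^ 2 * d * (2 * k * (d : ℝ) ^ (k + 2) * cM) +
            2 * 2 ^ (2 * (j' : ℕ) + k) * d * D) * Θ₀ ≤ S₂ * Θ₀ := by
          refine mul_le_mul_of_nonneg_right ?_ hΘ₀0
          rw [hS₂]
          refine add_le_add ?_ ?_
          · exact mul_le_mul (mul_le_mul_of_nonneg_right (mul_le_mul_of_nonneg_left
              (pow_le_pow_left₀ hQ0 hQ 2) zero_le_two) hd0) hC₁ hC₁0 (by positivity)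
          · exact mul_le_mul_of_nonneg_right (mul_le_mul_of_nonneg_right
              (mul_le_mul_of_nonneg_left hQ zero_le_two) hd0) hD
        rw [hux, huy]
        have hs0 := Real.sqrt_nonneg (Θ₀ * U)
        calc scaledSup A M f j' (k + 1) ≤ _ := hss
          _ ≤ S₁ * Real.sqrt (Θ₀ * U) + S₂ * Θ₀ := add_le_add hsq hlin
          _ ≤ C * Real.sqrt (Θ₀ * U) + C * Θ₀ := by
              rw [hCS]
              exact add_le_add (mul_le_mul_of_nonneg_right (by linarith) hs0)
                (mul_le_mul_of_nonneg_right (by linarith) hΘ₀0)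
          _ = C * (Real.sqrt (Θ₀ * U) + Θ₀) := by ring
  -- the closing lemma
  have hclose := closing hC1 u rank hn hu0 ha0 huU hmax hroot hstep
  -- read off `k ≤ kmax` at level `0`
  have hkK : k < kmax + 1 := Nat.lt_succ_of_le hk
  have h1 : ∑ w : Fin k → ι, ‖M 0 (wordEnd A (List.ofFn w) f)‖ = levelSum A M f 0 k 0 := by
    simp [levelSum]
  have h2 : levelSum A M f 0 k 0 ≤ u (⟨0, hA₀⟩, ⟨k, hkK⟩) := by
    have := levelSum_le_mul_scaledSup (A := A) (f := f) hbdd 0 k 0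
    simpa using this
  calc ∑ w : Fin k → ι, ‖M 0 (wordEnd A (List.ofFn w) f)‖ = levelSum A M f 0 k 0 := h1
    _ ≤ u (⟨0, hA₀⟩, ⟨k, hkK⟩) := h2
    _ ≤ U := huU _
    _ ≤ 2 * closingL C (A₀ * (kmax + 1)) (1 / 2) * a := hclose
    _ = interiorConst (Fintype.card ι) cM D A₀ rM kmax * a := rfl

end Nelson

end Literature.Analysis.OperatorTheory
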